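import Literature.Barriers.QuantumAdvantage.PPolyOraclesProofs
import Literature.Barriers.QuantumAdvantage.SampPRelSubsetSampBQPRel
import Literature.Computability.QuantumComplexity.CWrapKernelRel
import Literature.Computability.QuantumComplexity.BPPRelSubsetBQPRel
import Literature.Computability.Cryptography.OracleAdversaryStringDecider
import Literature.Computability.Cryptography.StatisticalDistanceMixtures
import HarnessLib

/-!
# Barrier `PPolyOracles` (Aaronson–Chen 2017, Thm. 8.1): the sampling-to-language bridge, proved

Third sibling proof file of `Literature/Barriers/QuantumAdvantage/PPolyOracles.lean`, discharging
the named fact of `PPolyOraclesProofs.lean`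

* `BQPRel_subset_BPPRel_of_sampBQPRel_subset` — "and consequently `BPP^O = BQP^O`"
  [AaronsonChen2017, Thm. 8.1, p. 32]: for every oracle language `A`,
  `SampBQP^A ⊆ SampBPP^A ⟹ BQP^A ⊆ BPP^A`,

by `BQPRel_subset_BPPRel_of_sampBQPRel_subset_holds`. The printed theorem asserts the
parenthetical without proof; it is the folklore step "the answer bit of a `BQP^O` machine is a
one-bit sampling problem; a `SampBPP^O` sampler within total variation `1/k` of it decides with
error `1/3 + 1/k`; amplify". In the tree's models (Q2 uniform Clifford+T families with XOR query
gates fed `|x⟩`, `BQPRel`; the same families fed `|⟨x, 1^k⟩⟩` with a polynomial-time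
post-processing, `SampBQPRel`; C4a PPT oracle adversaries, `SampPRel`; G01 transcript machines,
`BPPRel = bp (P^O)`) the proof has a quantum and a classical half:

* **Quantum half** (`exists_uniform_kernel_map_fstF_eq`, `uniformKernel_map_mem_SampBQPRel`,
  `uniformKernel_mem_SampBQPRel`): the whole measured output `F.kernel A x` of a poly-time uniform
  family WITH ORACLE GATES, post-processed by any `post ∈ FP`, is a `SampBQP^A` problem — a
  uniform family `F'` fed `|⟨x, y⟩⟩` runs `F` on the first component: the relativized classical
  wrap in kernel form (`exists_uniform_classicalWrap_rel`, `QuantumComplexity/CWrapKernelRel.lean`: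
  Bernstein–Vazirani's "classical computation is free inside `BQP`", §8, with query gates placed
  verbatim) with pre-processor `fstF` and the self-delimiting post-processor `⟨x, y⟩ ↦ ⟨y, ε⟩`
  gives, for every event, `Pr_F[y ∈ S] ≤ Pr_{F'}[⟨y, ε⟩ <+: z, y ∈ S] ≤ Pr_{F'}[fstF z ∈ S]`, and
  two distributions comparable on all events coincide (`pmf_eq_of_toOuterMeasure_le`), so
  `(F'.kernel A ⟨x, y⟩).map fstF = F.kernel A x` EXACTLY (accuracy `0 ≤ 1/k`).
* **Classical half**: by hypothesis a PPT oracle adversary `𝒜` samples `F.kernel A x` within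
  `1/k` on `⟨x, 1^k⟩`; fix `k = 12` by polynomial-time input preprocessing
  (`OracleAdversary.exists_ppt_outputPMF_precomp`); the probability that its output starts with
  `1` is within `1/12` of `Pr[F's output starts with 1] = F.acceptProbOn A x`
  (`PMF.abs_toReal_toOuterMeasure_sub_le_tvDist`, `kernelProb_prefix_true_eq_acceptProbOn`), which
  is `≥ 2/3` on `L` and `≤ 1/3` off `L`; so `L ∈ BPP^A` by the string-output decider bridge
  `OracleAdversary.mem_BPPRel_of_headProb_abs_sub_le` (`Cryptography/OracleAdversaryStringDecider.lean`:
  witness language in `P^A` from the `FP^A` clocked run, majority-of-three amplification of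
  `OracleBPPAmplification.lean`).

**Assemblies.** With the fact discharged, Thm. 8.1 needs three leaves
(`aaronsonChen2017_thm81_of_three_leaves`: Lemma 8.2, `SampBPP^A ⊆ SampBQP^A`, `BPP^A ⊆ BQP^A`),
and since the tree reduces the last two to the relativized reversible simulation
(`SampPRel_subset_SampBQPRel_of_sim`, `BPPRel_ofLanguage_subset_BQPRel_of_sim`), TWO:
`aaronsonChen2017_thm81_of_lem82_of_sim : aaronsonChen2017_lem82 → uniformOracleCoinSimulation → aaronsonChen2017_thm81`;
the barrier `PPolyOracles` from seven (`PPolyOracles_of_seven_leaves`) resp. six leaves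
(`PPolyOracles_of_leaves_of_sim`); and the sampling/language comparison
`BQPRel_eq_BPPRel_of_sampBQPRel_eq` (`SampBQP^A = SampBPP^A ⟹ BQP^A = BPP^A`, given
`BPP^A ⊆ BQP^A`).

## Sources

* [AaronsonChen2017] S. Aaronson, L. Chen, CCC 2017 (arXiv:1612.05903), Thm. 8.1 (p. 32:
  "(and consequently `BPP^O = BQP^O`)"), Def. 2.3 and §2.2 (p. 12: `SampBPP`, `SampBQP`, oracle
  versions, canonical form of `SampBQP` oracle algorithms), read via `lit read arxiv:1612.05903`.
* [BernsteinVazirani1997] / [BernsteinVazirani1997SICOMP] §8 and §8.3, through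
  `CWrapKernelRel.lean`, `BPPRelSubsetBQPRel.lean`, `SampPRelSubsetSampBQPRel.lean`.
* [AroraBarakCC2009] Def. 7.1–7.3, §7.4.1, §3.4, through `OracleAdversaryStringDecider.lean`.
-/

noncomputable section

namespace Literature.Barriers.QuantumAdvantage

open _root_.MeasureTheory _root_.Computability
open Literature.Computability.Complexity Literature.Computability.Complexity.Brick
  Literature.Computability.Cryptography Literature.Computability.QuantumComplexity

/-! ### Quantum half: exact quantum samplers are `SampBQP^A` samplers -/

/-- **A uniform oracle family can be run on the first component of a pair, exactly.** For a
poly-time uniform Clifford+T family `F` (query gates allowed) there is a poly-time uniform family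
`F'` such that, for every oracle `A` and all `x, y`, the measured output of `F'` on `|⟨x, y⟩⟩|0…0⟩`
read through the first pairing projection has EXACTLY the law of the measured output of `F` on
`|x⟩|0…0⟩`: the relativized classical wrap (`exists_uniform_classicalWrap_rel`, pre-processor
`fstF`, post-processor `⟨x, y⟩ ↦ ⟨y, ε⟩`) dominates `F`'s law on every event after reading the
self-delimited prefix back (`fstF_eq_of_boolPair_nil_prefix`), and domination on all events is
equality (`pmf_eq_of_toOuterMeasure_le`).
[cite: BernsteinVazirani1997, §8 and §8.3 (classical computation inside oracle quantum machines)] -/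
theorem exists_uniform_kernel_map_fstF_eq {F : QCircuitFamily cliffordT} (hU : F.IsUniform) :
    ∃ F' : QCircuitFamily cliffordT, F'.IsUniform ∧
      ∀ (A : Language Bool) (x y : List Bool), (F'.kernel A (boolPair x y)).map fstF = F.kernel A x := by
  obtain ⟨F', hU', hF'⟩ := exists_uniform_classicalWrap_rel fstF_mem_FP
    (fanoutFn_mem_FP sndF_mem_FP (const_mem_FP [])) hU
  refine ⟨F', hU', fun A x y => ?_⟩
  symm
  refine pmf_eq_of_toOuterMeasure_le _ _ fun S => ?_
  have hdom := hF' A (boolPair x y) S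
  rw [fstF_boolPair] at hdom
  calc (F.kernel A x).toOuterMeasure S
      = ENNReal.ofReal (F.kernelProb A x S) := by
        rw [QCircuitFamily.kernelProb, ENNReal.ofReal_toReal (pmf_toOuterMeasure_ne_top _ _)]
    _ ≤ ENNReal.ofReal (F'.kernelProb A (boolPair x y)
          {z | ∃ s ∈ S, fanoutFn sndF (fun _ => []) (boolPair (boolPair x y) s) <+: z}) :=
        ENNReal.ofReal_le_ofReal hdom
    _ = (F'.kernel A (boolPair x y)).toOuterMeasure
          {z | ∃ s ∈ S, fanoutFn sndF (fun _ => []) (boolPair (boolPair x y) s) <+: z} := by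
        rw [QCircuitFamily.kernelProb, ENNReal.ofReal_toReal (pmf_toOuterMeasure_ne_top _ _)]
    _ ≤ (F'.kernel A (boolPair x y)).toOuterMeasure (fstF ⁻¹' S) := by
        refine (F'.kernel A (boolPair x y)).toOuterMeasure.mono ?_
        rintro z ⟨s, hs, hpre⟩
        rw [fanoutFn_apply, sndF_boolPair] at hpre
        show fstF z ∈ S
        rw [fstF_eq_of_boolPair_nil_prefix hpre]
        exact hs
    _ = ((F'.kernel A (boolPair x y)).map fstF).toOuterMeasure S := (PMF.toOuterMeasure_map_apply _ _ _).symm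

/-- **Exact quantum samplers without an accuracy parameter are `SampBQP^A` samplers** ("pad the
accuracy parameter away uniformly"): for a poly-time uniform family `F` with query gates to `A`
and a polynomial-time `post`, the sampling problem `x ↦ post(measured output of F on |x⟩|0…0⟩)`
is in `SampBQPRel A` — the family of `exists_uniform_kernel_map_fstF_eq` fed `|⟨x, 1^k⟩⟩` with
post-processing `post ∘ fstF` samples it with total variation `0 ≤ 1/k`.
[cite: AaronsonChen2017, Def. 2.3 and §2.2 (SampBQP^O, canonical form; an algorithm may ignore ε)] -/
theorem uniformKernel_map_mem_SampBQPRel (A : Language Bool) {F : QCircuitFamily cliffordT} (hU : F.IsUniform)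
    {post : List Bool → List Bool}
    (hpost : PolyTimeComputable (id : List Bool → List Bool) (id : List Bool → List Bool) post) :
    (fun x => (F.kernel A x).map post) ∈ SampBQPRel A := by
  obtain ⟨F', hU', hF'⟩ := exists_uniform_kernel_map_fstF_eq hU
  refine ⟨F', post ∘ fstF, hU', comp_mem_FP hpost fstF_mem_FP, fun x k _ => ?_⟩
  dsimp only
  rw [← PMF.map_comp, hF' A x (unaryEncodeNat k), PMF.tvDist_self]
  positivity

/-- In particular the whole measured output of a uniform oracle family is a `SampBQP^A` problem.
[cite: AaronsonChen2017, Def. 2.3 and §2.2] -/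
theorem uniformKernel_mem_SampBQPRel (A : Language Bool) {F : QCircuitFamily cliffordT} (hU : F.IsUniform) :
    F.kernel A ∈ SampBQPRel A := by
  have h := uniformKernel_map_mem_SampBQPRel A hU (post := id) (PolyTimeComputable.id _)
  simp only [PMF.map_id] at h
  exact h

/-! ### The bridge -/

/-- The pad `x ↦ ⟨x, 1¹²⟩` fixing the accuracy parameter is polynomial-time (a fan-out brick).
[folklore] -/
theorem pad12_mem_FP :
    PolyTimeComputable (id : List Bool → List Bool) (id : List Bool → List Bool)
      (fun x : List Bool => boolPair x (unaryEncodeNat 12)) := by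
  have h : (fun x : List Bool => boolPair x (unaryEncodeNat 12)) = fanoutFn id (fun _ => unaryEncodeNat 12) :=
    funext fun x => by simp [fanoutFn_apply]
  rw [h]
  exact fanoutFn_mem_FP (PolyTimeComputable.id _) (const_mem_FP _)

/-- The event "the output string starts with `1`" in its two spellings. [folklore] -/
theorem setOf_singleton_true_prefix_eq :
    {y : List Bool | [true] <+: y} = {s : List Bool | s.head? = some true} :=
  Set.ext fun _ => List.singleton_prefix_iff_head?_eq_some

/-- **Discharge of `BQPRel_subset_BPPRel_of_sampBQPRel_subset`** ("and consequently
`BPP^O = BQP^O`", Aaronson–Chen 2017, Thm. 8.1): for every oracle language `A`, if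
`SampBQP^A ⊆ SampBPP^A` then `BQP^A ⊆ BPP^A`. For `L ∈ BQP^A` by the uniform family `F`: its
measured output is a `SampBQP^A` problem (`uniformKernel_mem_SampBQPRel`), hence sampled within
`1/k` on `⟨x, 1^k⟩` by a PPT oracle adversary; padding the input to `k = 12`
(`OracleAdversary.exists_ppt_outputPMF_precomp`) gives an adversary whose first output bit is `1`
with probability within `1/12` of `F.acceptProbOn A x` (every event moves by at most the total
variation, `PMF.abs_toReal_toOuterMeasure_sub_le_tvDist`; the first wire is the acceptance
probability, `kernelProb_prefix_true_eq_acceptProbOn`), i.e. it decides `L` with error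
`≤ 5/12 < 1/2`, so `L ∈ BPP^A` (`OracleAdversary.mem_BPPRel_of_headProb_abs_sub_le`).
[cite: AaronsonChen2017, Thm. 8.1 ("and consequently BPP^O = BQP^O", p. 32)] -/
theorem BQPRel_subset_BPPRel_of_sampBQPRel_subset_holds : BQPRel_subset_BPPRel_of_sampBQPRel_subset := by
  intro A hS L hL
  obtain ⟨F, hU, hacc⟩ := hL
  obtain ⟨𝒜, h𝒜, hclose⟩ := hS (uniformKernel_mem_SampBQPRel A hU)
  obtain ⟨𝒜', h𝒜', hrun⟩ := 𝒜.exists_ppt_outputPMF_precomp h𝒜 pad12_mem_FP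
  refine 𝒜'.mem_BPPRel_of_headProb_abs_sub_le h𝒜' (π := F.acceptProbOn A) (η := 1 / 12) (by norm_num)
    (fun x => ?_) (fun x hx => (hacc x).1 hx) (fun x hx => (hacc x).2 hx)
  rw [hrun, ← kernelProb_prefix_true_eq_acceptProbOn F A x, QCircuitFamily.kernelProb,
    setOf_singleton_true_prefix_eq]
  refine (PMF.abs_toReal_toOuterMeasure_sub_le_tvDist _ _ _).trans ?_
  exact (hclose x 12 (by norm_num)).trans (le_of_eq (by norm_num))

/-! ### Consequences: Theorem 8.1 and the barrier from fewer leaves -/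

/-- **`SampBQP^A = SampBPP^A ⟹ BQP^A = BPP^A`** for every oracle language `A`, given the
classical-in-quantum inclusion `BPP^A ⊆ BQP^A` (the discharged bridge replaces the fourth
hypothesis of `pPolyOracleSamplingSeparation_of_pPolyOracleSeparation`).
[cite: AaronsonChen2017, Thm. 8.1 ("and consequently", p. 32)] -/
theorem BQPRel_eq_BPPRel_of_sampBQPRel_eq (h₃ : BPPRel_ofLanguage_subset_BQPRel) {A : Language Bool}
    (heq : SampBQPRel A = SampPRel (Oracle.ofLanguage A)) : BQPRel A = BPPRel (Oracle.ofLanguage A) :=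
  Set.Subset.antisymm (BQPRel_subset_BPPRel_of_sampBQPRel_subset_holds A heq.le) (h₃ A)

/-- A language separation relative to `O ∈ P/poly` is a sampling separation relative to `O`,
now under the single leaf `BPP^A ⊆ BQP^A`. [cite: AaronsonChen2017, Thm. 8.1 (p. 32)] -/
theorem pPolyOracleSamplingSeparation_of_pPolyOracleSeparation' (h₃ : BPPRel_ofLanguage_subset_BQPRel)
    (hsep : PPolyOracleSeparation) : PPolyOracleSamplingSeparation :=
  pPolyOracleSamplingSeparation_of_pPolyOracleSeparation h₃ BQPRel_subset_BPPRel_of_sampBQPRel_subset_holds hsep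

/-- **Thm. 8.1 from three leaves**: Lemma 8.2 (`aaronsonChen2017_lem82`), `SampBPP^A ⊆ SampBQP^A`,
`BPP^A ⊆ BQP^A` (the fourth hypothesis of `aaronsonChen2017_thm81_of_lem82` discharged).
[cite: AaronsonChen2017, Thm. 8.1 and Lemma 8.2 (p. 32)] -/
theorem aaronsonChen2017_thm81_of_three_leaves (h82 : aaronsonChen2017_lem82)
    (h₂ : SampPRel_subset_SampBQPRel) (h₃ : BPPRel_ofLanguage_subset_BQPRel) : aaronsonChen2017_thm81 :=
  aaronsonChen2017_thm81_of_lem82 h82 h₂ h₃ BQPRel_subset_BPPRel_of_sampBQPRel_subset_holds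

/-- **Thm. 8.1 from two leaves**: Lemma 8.2 and the relativized reversible simulation
`uniformOracleCoinSimulation`, which the tree shows to imply both classical-in-quantum inclusions
(`SampPRel_subset_SampBQPRel_of_sim`, `BPPRel_ofLanguage_subset_BQPRel_of_sim`).
[cite: AaronsonChen2017, Thm. 8.1 (p. 32)] -/
theorem aaronsonChen2017_thm81_of_lem82_of_sim (h82 : aaronsonChen2017_lem82)
    (hsim : uniformOracleCoinSimulation) : aaronsonChen2017_thm81 :=
  aaronsonChen2017_thm81_of_three_leaves h82 (SampPRel_subset_SampBQPRel_of_sim hsim)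
    (BPPRel_ofLanguage_subset_BQPRel_of_sim hsim)

/-- **`PPolyOracles` from seven leaves** (the eight of `PPolyOracles_of_leaves` less the bridge
discharged here): HILL, GGM, Luby–Rackoff, the §7.2–7.3 fact, Lemma 8.2, `SampBPP^A ⊆ SampBQP^A`,
`BPP^A ⊆ BQP^A`. [cite: AaronsonChen2017, Thm. 7.6, Thm. 8.1, Lemma 7.4, Lemma 8.2] -/
theorem PPolyOracles_of_seven_leaves (hHILL : PRGExist_iff_OWFExist) (hGGM : PRFExist_of_PRGExist)
    (hLR : PRPExist_of_PRFExist) (h76 : aaronsonChen2017_thm76_of_prp)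
    (h82 : aaronsonChen2017_lem82) (h₂ : SampPRel_subset_SampBQPRel)
    (h₃ : BPPRel_ofLanguage_subset_BQPRel) : PPolyOracles :=
  PPolyOracles_of_leaves hHILL hGGM hLR h76 h82 h₂ h₃ BQPRel_subset_BPPRel_of_sampBQPRel_subset_holds

/-- **`PPolyOracles` from six leaves**: HILL, GGM, Luby–Rackoff, the §7.2–7.3 fact, Lemma 8.2 and
the relativized reversible simulation. [cite: AaronsonChen2017, Thm. 7.6, Thm. 8.1, Lemma 7.4, Lemma 8.2] -/
theorem PPolyOracles_of_leaves_of_sim (hHILL : PRGExist_iff_OWFExist) (hGGM : PRFExist_of_PRGExist)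
    (hLR : PRPExist_of_PRFExist) (h76 : aaronsonChen2017_thm76_of_prp)
    (h82 : aaronsonChen2017_lem82) (hsim : uniformOracleCoinSimulation) : PPolyOracles :=
  PPolyOracles_of_seven_leaves hHILL hGGM hLR h76 h82 (SampPRel_subset_SampBQPRel_of_sim hsim)
    (BPPRel_ofLanguage_subset_BQPRel_of_sim hsim)

end Literature.Barriers.QuantumAdvantage

end
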